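import Mathlib
import HarnessLib

/-!
# The Veronese cone ring `k[s², st, t²]` is a direct summand of `k[s, t]`

Route `FrobeniusLadder`, crux `FRationalResolution` (stmt-ResolutionOfSingularities-15317), line
`Sketch`. The inserted rung "weakly F-regular" (every ideal of the domain stalk is tightly closed,
inline clause) is closed under direct summands (`weaklyFRegularClause_of_retract`) and contains the
regular domains (`weaklyFRegularClause_of_isRegularRing`). This file supplies the standard example
feeding those two facts: the second Veronese subring
`R = k[s², st, t²] = Algebra.adjoin k {X 0 ^ 2, X 0 * X 1, X 1 ^ 2} ⊆ S = k[s, t]`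
(the coordinate ring of the quadric cone `xy = z²`, an `A₁` surface singularity) is a direct summand
of the polynomial ring: there is an `R`-linear retraction `ρ : S → R` with `ρ ∘ (R ↪ S) = id`.

Proof. Grade `S = MvPolynomial (Fin 2) k` by the parity of the total degree, i.e. by the weight
`w : Fin 2 → ZMod 2`, `w _ = 1` (`MvPolynomial.IsWeightedHomogeneous`). Then
* every element of `R` is weighted homogeneous of weight `0` ("even"): the three generators are, and
  weight-`0` polynomials form a subalgebra (`Algebra.adjoin_induction`);
* conversely every even polynomial lies in `R`: it is a `k`-combination of monomials `s^a t^b` with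
  `a + b` even, and `s^a t^b = (s²)^i (t²)^j` or `(s²)^i (t²)^j (st)` according to the common parity
  of `a, b`;
* the projection `E = weightedHomogeneousComponent w 0` onto the even part is `k`-linear, satisfies
  `E (r f) = r E f` for even `r` (coefficientwise: in `coeff_mul` the factor `coeff a r` vanishes
  unless `a` is even, and then `b = d - a` has the parity of `d`), and fixes even polynomials.
So `ρ f := ⟨E f, _⟩` is the required retraction. No hypothesis on the field `k` is used.
-/

-- single-problem summit: the doubled namespace component is forced
set_option linter.dupNamespace false

noncomputable section

namespace Summit.ResolutionOfSingularities.ResolutionOfSingularities.Theorems.FRationalResolution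

open MvPolynomial Finsupp

/-- Multiplication by a weighted homogeneous polynomial of weight `0` commutes with taking weighted
homogeneous components: `(r f)_n = r f_n`. Coefficientwise: in `coeff d (r * f) = ∑_{a+b=d} rₐ f_b`
only the pairs with `weight a = 0`, hence `weight b = weight d`, contribute. [folklore] -/
theorem veronese_retract_weightedHomogeneousComponent_mul {σ R M : Type*} [CommSemiring R]
    [AddCommMonoid M] {w : σ → M} {r : MvPolynomial σ R} (hr : IsWeightedHomogeneous w r 0)
    (n : M) (f : MvPolynomial σ R) :
    weightedHomogeneousComponent w n (r * f) = r * weightedHomogeneousComponent w n f := by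
  classical
  ext d
  rw [coeff_weightedHomogeneousComponent, coeff_mul, coeff_mul]
  split_ifs with hd
  · refine Finset.sum_congr rfl (fun x hx => ?_)
    rw [coeff_weightedHomogeneousComponent]
    by_cases hx1 : coeff x.1 r = 0
    · simp only [hx1, zero_mul]
    · have hx2 : weight w x.2 = n := by
        rw [← hd, ← Finset.HasAntidiagonal.mem_antidiagonal.mp hx, map_add, hr hx1, zero_add]
      rw [if_pos hx2]
  · symm
    refine Finset.sum_eq_zero (fun x hx => ?_)
    rw [coeff_weightedHomogeneousComponent]
    by_cases hx1 : coeff x.1 r = 0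
    · simp only [hx1, zero_mul]
    · rw [if_neg, mul_zero]
      intro hx2
      apply hd
      rw [← Finset.HasAntidiagonal.mem_antidiagonal.mp hx, map_add, hr hx1, zero_add, hx2]

/-- The three generators `s², st, t²` of the Veronese cone ring, and hence (by
`Algebra.adjoin_induction`) all of its elements, are weighted homogeneous of weight `0` for the
parity weight `w _ = 1 : ZMod 2` ("even polynomials"). [folklore] -/
theorem veronese_retract_isWeightedHomogeneous (k : Type) [Field k] {r : MvPolynomial (Fin 2) k}
    (hr : r ∈ Algebra.adjoin k
      ({X 0 ^ 2, X 0 * X 1, X 1 ^ 2} : Set (MvPolynomial (Fin 2) k))) :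
    IsWeightedHomogeneous (fun _ : Fin 2 => (1 : ZMod 2)) r 0 := by
  refine Algebra.adjoin_induction ?_ ?_ ?_ ?_ hr
  · intro x hx
    have hX : ∀ i : Fin 2, IsWeightedHomogeneous (fun _ : Fin 2 => (1 : ZMod 2))
        (X i : MvPolynomial (Fin 2) k) 1 := fun i =>
      isWeightedHomogeneous_X k (fun _ : Fin 2 => (1 : ZMod 2)) i
    have h2 : (1 : ZMod 2) + 1 = 0 := by decide
    simp only [Set.mem_insert_iff, Set.mem_singleton_iff] at hx
    rcases hx with rfl | rfl | rfl
    · simpa only [pow_two, h2] using (hX 0).mul (hX 0)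
    · simpa only [h2] using (hX 0).mul (hX 1)
    · simpa only [pow_two, h2] using (hX 1).mul (hX 1)
  · intro c
    rw [MvPolynomial.algebraMap_eq]
    exact isWeightedHomogeneous_C _ c
  · intro x y _ _ hx hy
    exact hx.add hy
  · intro x y _ _ hx hy
    simpa only [add_zero] using hx.mul hy

/-- An even-degree monomial `s^a t^b` (`a + b` even) lies in the Veronese cone ring `k[s², st, t²]`:
`s^a t^b = (s²)^i (t²)^j` if `a = 2i, b = 2j`, and `= (s²)^i (t²)^j (st)` if `a = 2i+1, b = 2j+1`.
[folklore] -/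
theorem veronese_retract_X_pow_mul_X_pow_mem (k : Type) [Field k] {a b : ℕ} (h : Even (a + b)) :
    (X 0 ^ a * X 1 ^ b : MvPolynomial (Fin 2) k) ∈ Algebra.adjoin k
      ({X 0 ^ 2, X 0 * X 1, X 1 ^ 2} : Set (MvPolynomial (Fin 2) k)) := by
  have h0 : (X 0 ^ 2 : MvPolynomial (Fin 2) k) ∈ Algebra.adjoin k
      ({X 0 ^ 2, X 0 * X 1, X 1 ^ 2} : Set (MvPolynomial (Fin 2) k)) :=
    Algebra.subset_adjoin (by simp)
  have h01 : (X 0 * X 1 : MvPolynomial (Fin 2) k) ∈ Algebra.adjoin k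
      ({X 0 ^ 2, X 0 * X 1, X 1 ^ 2} : Set (MvPolynomial (Fin 2) k)) :=
    Algebra.subset_adjoin (by simp)
  have h1 : (X 1 ^ 2 : MvPolynomial (Fin 2) k) ∈ Algebra.adjoin k
      ({X 0 ^ 2, X 0 * X 1, X 1 ^ 2} : Set (MvPolynomial (Fin 2) k)) :=
    Algebra.subset_adjoin (by simp)
  obtain ⟨c, hc⟩ := h
  rcases Nat.even_or_odd a with ⟨i, rfl⟩ | ⟨i, rfl⟩
  · obtain ⟨j, rfl⟩ : ∃ j, b = j + j := ⟨b / 2, by omega⟩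
    have e : (X 0 ^ (i + i) * X 1 ^ (j + j) : MvPolynomial (Fin 2) k) =
        (X 0 ^ 2) ^ i * (X 1 ^ 2) ^ j := by ring
    rw [e]
    exact Subalgebra.mul_mem _ (Subalgebra.pow_mem _ h0 i) (Subalgebra.pow_mem _ h1 j)
  · obtain ⟨j, rfl⟩ : ∃ j, b = 2 * j + 1 := ⟨b / 2, by omega⟩
    have e : (X 0 ^ (2 * i + 1) * X 1 ^ (2 * j + 1) : MvPolynomial (Fin 2) k) =
        (X 0 ^ 2) ^ i * (X 1 ^ 2) ^ j * (X 0 * X 1) := by ring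
    rw [e]
    exact Subalgebra.mul_mem _
      (Subalgebra.mul_mem _ (Subalgebra.pow_mem _ h0 i) (Subalgebra.pow_mem _ h1 j)) h01

/-- Every even polynomial (weighted homogeneous of weight `0` for the parity weight) lies in the
Veronese cone ring `k[s², st, t²]`: write it as a `k`-combination of its (even) monomials
(`MvPolynomial.as_sum`) and use `veronese_retract_X_pow_mul_X_pow_mem`. [folklore] -/
theorem veronese_retract_mem_adjoin (k : Type) [Field k] {f : MvPolynomial (Fin 2) k}
    (hf : IsWeightedHomogeneous (fun _ : Fin 2 => (1 : ZMod 2)) f 0) :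
    f ∈ Algebra.adjoin k ({X 0 ^ 2, X 0 * X 1, X 1 ^ 2} : Set (MvPolynomial (Fin 2) k)) := by
  rw [f.as_sum]
  refine Subalgebra.sum_mem _ (fun d hd => ?_)
  have hw : weight (fun _ : Fin 2 => (1 : ZMod 2)) d = 0 := hf (MvPolynomial.mem_support_iff.mp hd)
  rw [weight_apply, Finsupp.sum_fintype d (fun _ c => c • (1 : ZMod 2)) (fun _ => zero_smul ℕ _),
    Fin.sum_univ_two,
    ← add_smul, nsmul_one, ZMod.natCast_eq_zero_iff_even] at hw
  rw [monomial_eq, Finsupp.prod_pow, Fin.prod_univ_two, C_mul']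
  exact Subalgebra.smul_mem _ (veronese_retract_X_pow_mul_X_pow_mem k hw) _

/-- **The Veronese cone ring is a direct summand of the polynomial ring.** For every field `k`
there is a `k[s², st, t²]`-linear retraction `ρ : k[s, t] → k[s², st, t²]` of the inclusion,
`ρ ∘ incl = id`: `ρ` is the projection onto the even part (the weight-`0` component for the parity
grading), which is linear over the even subring and fixes it. [folklore; cf. Hochster–Huneke 1990,
discussion after Prop. 4.12; Bruns–Herzog 1998, Exercise 10.3] -/
theorem veronese_retract (k : Type) [Field k] :
    ∃ ρ : MvPolynomial (Fin 2) k →ₗ[Algebra.adjoin k ({MvPolynomial.X 0 ^ 2,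
      MvPolynomial.X 0 * MvPolynomial.X 1, MvPolynomial.X 1 ^ 2} : Set (MvPolynomial (Fin 2) k))]
      Algebra.adjoin k ({MvPolynomial.X 0 ^ 2, MvPolynomial.X 0 * MvPolynomial.X 1,
        MvPolynomial.X 1 ^ 2} : Set (MvPolynomial (Fin 2) k)),
    ∀ r : Algebra.adjoin k ({MvPolynomial.X 0 ^ 2, MvPolynomial.X 0 * MvPolynomial.X 1,
      MvPolynomial.X 1 ^ 2} : Set (MvPolynomial (Fin 2) k)),
    ρ (algebraMap (Algebra.adjoin k ({MvPolynomial.X 0 ^ 2, MvPolynomial.X 0 * MvPolynomial.X 1,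
      MvPolynomial.X 1 ^ 2} : Set (MvPolynomial (Fin 2) k))) (MvPolynomial (Fin 2) k) r) = r := by
  refine ⟨{ toFun := fun f => ⟨weightedHomogeneousComponent (fun _ : Fin 2 => (1 : ZMod 2)) 0 f,
              veronese_retract_mem_adjoin k
                (weightedHomogeneousComponent_isWeightedHomogeneous 0 f)⟩
            map_add' := fun f g => Subtype.ext (map_add _ f g)
            map_smul' := fun r f => Subtype.ext ?_ }, fun r => Subtype.ext ?_⟩
  · simp only [RingHom.id_apply, Subalgebra.smul_def, smul_eq_mul, Subalgebra.coe_mul]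
    exact veronese_retract_weightedHomogeneousComponent_mul
      (veronese_retract_isWeightedHomogeneous k r.2) 0 f
  · exact weightedHomogeneousComponent_eq_self (veronese_retract_isWeightedHomogeneous k r.2)

end Summit.ResolutionOfSingularities.ResolutionOfSingularities.Theorems.FRationalResolution

end
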